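import Mathlib.Analysis.Convex.Deriv
import Summits.HubbardSuperconductivity.HubbardSuperconductivity.Theorems.ThermalWedgeTwSeededEnsembleEquivalenceRConcReduction
import Summits.HubbardSuperconductivity.HubbardSuperconductivity.Theorems.ThermalWedgeTwSeededEnsembleEquivalenceRUniqOfPairingSaturation
import Literature.MathematicalPhysics.QuantumLattice.DWaveSourceLeeYang

/-!
# Reduction theorems: `TwSeededEnsembleEquivalenceR` from CHORD / SUSCEPTIBILITY MONOTONICITY of the sourced Gibbs state
# (crux stmt-HubbardSuperconductivity-15581, line `Sketch` v8.5; pool seat 0, session 74)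

Support file (`--supports stmt-HubbardSuperconductivity-15581`; sorry-free; no definition).

`…RConcReduction.lean` (p145797) reduced the crux `TwSeededEnsembleEquivalenceR` (R) to FV-CONC: concavity of the
finite-volume cold sourced pressure `s ↦ p̃_L(μ, √s) = log Z_L(e^{a/U}; dWaveSourceTorus L U μ √s)/(e^{a/U} L²)` in the
SQUARED source `s = h²`, eventually in `L`. That is a statement about a thermodynamic potential. A fermionic
(multiscale) expansion, which is what the remaining physics input calls for, outputs CORRELATION FUNCTIONS of the
sourced Gibbs state `⟨·⟩_h = ⟨·⟩_{β, dWaveSourceTorus L U μ h}`. This file restates the physics debt of R in that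
currency, as kernel-checked reductions, with `Q = Δ_d + Δ_dᴴ` the `d`-wave pair source operator:

* `chr_fvChord_iff_fvConcavity` — for every finite torus, `β > 0`, `R > 0`:
  **FV-CONC on `[0, R²]` ⟺ FV-CHORD on `(0, R]`**, where FV-CHORD says that the CHORD PAIR AMPLITUDE
  `h ↦ Re⟨Q⟩_h / h` (induced `d`-wave pair amplitude per unit source) is non-increasing: the pair response to the
  pair source has diminishing returns. (`d/ds p̃_L(μ,√s) = Re⟨Q⟩_{√s}/(2√s L²)`, `chr_hasDerivAt_sourcedPressure`;
  a `C¹` function of `√s` is concave in `s` iff its derivative divided by `h = √s` is non-increasing —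
  `chr_concaveOn_comp_sqrt_of_antitoneOn`, `chr_antitoneOn_of_concaveOn_comp_sqrt`.)
* `twR_of_fvChordMonotone` — **FV-CHORD (eventually in `L`, at `β = e^{a/U}`, on `(0, 13g+1]`) ⟹ R**, with NO use of
  `TwSourcedCondensation` (stmt-1697); composition with `twR_of_fvConcavity`.
* `twR_of_fvSusceptibilityMonotone` — **FV-MONO-χ ⟹ R**: it suffices that the truncated Duhamel (Kubo–Mori–Bogoliubov)
  pair susceptibility AT FINITE SOURCE, `b_L(h) = Re (Q,Q)^{Duh}_h − (Re⟨Q⟩_h)²` — which is `β⁻¹ d/dh Re⟨Q⟩_h`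
  (`hasDerivAt_re_gibbsState_source`) — is non-increasing in `h ∈ [0, 13g+1]`, eventually in `L`. (With
  `⟨Q⟩_0 = 0` by the gauge symmetry, `gibbsState_pairSource_eq_zero`, a concave pair-amplitude curve through the
  origin has non-increasing chords: `chr_antitoneOn_div_of_antitoneOn_deriv`.) This is the GHS-type shape
  `d³/dh³ log Z_L(h) ≤ 0 (h ≥ 0)`; it is STRONGER than FV-CHORD and is offered only as the expansion-native sufficient
  condition (third source-derivative of the sourced pressure = fully truncated three-point function of `Q`).
* `twR_of_condensation_of_fvDeepChordMonotone` — `TwSourcedCondensation` + FV-DEEP-CHORD (chords non-increasing only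
  on the regulated deep range `[e^{−a/(4U)}, 13g+1]`, all small exponents `a`) ⟹ R; composition with
  `twR_of_condensation_of_fvDeepConcavity` (`(e^{−a/(4U)})² = e^{−a/(2U)}`).

Calibration / status: at `U = 0` FV-CHORD holds for every `β` (mode-wise, `E ↦ tanh(βE/2)/E` decreasing;
`cuq_modeG_strictConcaveOn`). Exact diagonalisation on 8- and 10-site tori (evidence compute-j021877 … j023133 on the
item) tested exactly the chord form `D(s) = ⟨Q⟩/(2√s)`: non-increasing at `U ≤ 2` in every run, small-source level
crossings at `U ≥ 4`. The remaining input of R is therefore: FV-CHORD (or FV-CONC) at `β = e^{a/U}`, `0 < U ≤ U₀`,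
`g ∈ [K'U, 1/10]` — a weak-coupling statement two source-derivatives deep, not in print. [folklore composition]
-/

set_option linter.dupNamespace false

namespace Summit.HubbardSuperconductivity.HubbardSuperconductivity.Theorems

open Matrix Set Literature.MathematicalPhysics.QuantumLattice
open Summit.HubbardSuperconductivity.HubbardSuperconductivity.Theses.ThermalWedge
open scoped ComplexOrder

noncomputable section

/-! ### Pure real analysis: concavity in `s = h²` versus monotone chords in `h` -/

/-- **Monotone chords ⟹ concavity in the square.** If `F` is continuous on `[r, R]` (`0 ≤ r < R`), has derivative
`F' h` at every `h ∈ (r, R)`, and `h ↦ F' h / h` is non-increasing on `(r, R)`, then `s ↦ F(√s)` is concave on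
`[r², R²]` (its derivative `F'(√s)/(2√s)` is non-increasing on the interior; `AntitoneOn.concaveOn_of_deriv`).
[folklore] -/
theorem chr_concaveOn_comp_sqrt_of_antitoneOn {F F' : ℝ → ℝ} {r R : ℝ} (hr : 0 ≤ r) (hrR : r < R)
    (hcont : ContinuousOn F (Icc r R)) (hder : ∀ h ∈ Ioo r R, HasDerivAt F (F' h) h)
    (hanti : AntitoneOn (fun h => F' h / h) (Ioo r R)) :
    ConcaveOn ℝ (Icc (r ^ 2) (R ^ 2)) (fun s => F (Real.sqrt s)) := by
  have hR : 0 < R := lt_of_le_of_lt hr hrR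
  -- `√` maps `[r², R²]` into `[r, R]` and `(r², R²)` into `(r, R)`
  have hsqrt_Icc : ∀ s ∈ Icc (r ^ 2) (R ^ 2), Real.sqrt s ∈ Icc r R := by
    intro s hs
    refine ⟨?_, ?_⟩
    · rw [← Real.sqrt_sq hr]; exact Real.sqrt_le_sqrt hs.1
    · rw [← Real.sqrt_sq hR.le]; exact Real.sqrt_le_sqrt hs.2
  have hsqrt_Ioo : ∀ s ∈ Ioo (r ^ 2) (R ^ 2), Real.sqrt s ∈ Ioo r R := by
    intro s hs
    have hs0 : 0 ≤ s := le_trans (sq_nonneg r) hs.1.le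
    refine ⟨?_, ?_⟩
    · rw [← Real.sqrt_sq hr]; exact Real.sqrt_lt_sqrt (sq_nonneg r) hs.1
    · rw [← Real.sqrt_sq hR.le]; exact Real.sqrt_lt_sqrt hs0 hs.2
  have hpos : ∀ s ∈ Ioo (r ^ 2) (R ^ 2), 0 < s := fun s hs => lt_of_le_of_lt (sq_nonneg r) hs.1
  -- derivative of `F ∘ √` on `(r², R²)`
  have hD : ∀ s ∈ Ioo (r ^ 2) (R ^ 2),
      HasDerivAt (fun s => F (Real.sqrt s)) (F' (Real.sqrt s) / Real.sqrt s / 2) s := by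
    intro s hs
    have h1 : HasDerivAt F (F' (Real.sqrt s)) (Real.sqrt s) := hder _ (hsqrt_Ioo s hs)
    have h2 : HasDerivAt Real.sqrt (1 / (2 * Real.sqrt s)) s := Real.hasDerivAt_sqrt (hpos s hs).ne'
    refine (h1.comp s h2).congr_deriv ?_
    have hsq : 0 < Real.sqrt s := Real.sqrt_pos.mpr (hpos s hs)
    field_simp
  refine AntitoneOn.concaveOn_of_deriv (convex_Icc _ _) ?_ ?_ ?_
  · exact hcont.comp Real.continuous_sqrt.continuousOn hsqrt_Icc
  · rw [interior_Icc]
    exact fun s hs => (hD s hs).differentiableAt.differentiableWithinAt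
  · rw [interior_Icc]
    intro s hs t ht hst
    rw [(hD s hs).deriv, (hD t ht).deriv]
    have h := hanti (hsqrt_Ioo s hs) (hsqrt_Ioo t ht) (Real.sqrt_le_sqrt hst)
    simp only at h
    linarith

/-- **Concavity in the square ⟹ monotone chords** (converse of `chr_concaveOn_comp_sqrt_of_antitoneOn`). If
`s ↦ F(√s)` is concave on `[r², R²]` (`0 ≤ r < R`) and `F` has derivative `F' h` at every `h ∈ (r, R]`, then
`h ↦ F' h / h` is non-increasing on `(r, R]` (`ConcaveOn.antitoneOn_deriv` on `(r², R²]`). [folklore] -/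
theorem chr_antitoneOn_of_concaveOn_comp_sqrt {F F' : ℝ → ℝ} {r R : ℝ} (hr : 0 ≤ r) (hrR : r < R)
    (hconc : ConcaveOn ℝ (Icc (r ^ 2) (R ^ 2)) (fun s => F (Real.sqrt s)))
    (hder : ∀ h ∈ Ioc r R, HasDerivAt F (F' h) h) :
    AntitoneOn (fun h => F' h / h) (Ioc r R) := by
  -- derivative of `G = F ∘ √` at squares of points of `(r, R]`
  have hD : ∀ h ∈ Ioc r R,
      HasDerivAt (fun s => F (Real.sqrt s)) (F' h / h / 2) (h ^ 2) := by
    intro h hh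
    have hh0 : 0 < h := lt_of_le_of_lt hr hh.1
    have hsq : Real.sqrt (h ^ 2) = h := Real.sqrt_sq hh0.le
    have h1 : HasDerivAt F (F' (Real.sqrt (h ^ 2))) (Real.sqrt (h ^ 2)) := by
      rw [hsq]; exact hder h hh
    have h2 : HasDerivAt Real.sqrt (1 / (2 * Real.sqrt (h ^ 2))) (h ^ 2) :=
      Real.hasDerivAt_sqrt (pow_pos hh0 2).ne'
    refine (h1.comp (h ^ 2) h2).congr_deriv ?_
    rw [hsq]
    field_simp
  -- concavity on the sub-interval `(r², R²]`, where `G` is differentiable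
  have hsub : Ioc (r ^ 2) (R ^ 2) ⊆ Icc (r ^ 2) (R ^ 2) := Ioc_subset_Icc_self
  have hconc' : ConcaveOn ℝ (Ioc (r ^ 2) (R ^ 2)) (fun s => F (Real.sqrt s)) :=
    hconc.subset hsub (convex_Ioc _ _)
  have hmemsq : ∀ h ∈ Ioc r R, h ^ 2 ∈ Ioc (r ^ 2) (R ^ 2) := by
    intro h hh
    have hh0 : 0 < h := lt_of_le_of_lt hr hh.1
    exact ⟨by nlinarith [hh.1], by nlinarith [hh.2]⟩
  have hsqrt_mem : ∀ s ∈ Ioc (r ^ 2) (R ^ 2), Real.sqrt s ∈ Ioc r R ∧ Real.sqrt s ^ 2 = s := by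
    intro s hs
    have hs0 : 0 ≤ s := le_trans (sq_nonneg r) hs.1.le
    have hR : 0 ≤ R := hr.trans hrR.le
    refine ⟨⟨?_, ?_⟩, Real.sq_sqrt hs0⟩
    · rw [← Real.sqrt_sq hr]; exact Real.sqrt_lt_sqrt (sq_nonneg r) hs.1
    · rw [← Real.sqrt_sq hR]; exact Real.sqrt_le_sqrt hs.2
  have hdiff : ∀ s ∈ Ioc (r ^ 2) (R ^ 2), DifferentiableAt ℝ (fun s => F (Real.sqrt s)) s := by
    intro s hs
    obtain ⟨hmem, hsq⟩ := hsqrt_mem s hs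
    have h := hD (Real.sqrt s) hmem
    rw [hsq] at h
    exact h.differentiableAt
  have hanti := hconc'.antitoneOn_deriv hdiff
  intro h₁ hh₁ h₂ hh₂ h12
  have hle : h₁ ^ 2 ≤ h₂ ^ 2 := by
    have : 0 < h₁ := lt_of_le_of_lt hr hh₁.1
    nlinarith
  have h := hanti (hmemsq h₁ hh₁) (hmemsq h₂ hh₂) hle
  rw [(hD h₁ hh₁).deriv, (hD h₂ hh₂).deriv] at h
  simp only
  linarith

/-- **Non-increasing derivative and `f 0 = 0` ⟹ non-increasing chords.** If `f` has derivative `f' h` at every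
`h ∈ [0, R]`, `f 0 = 0`, and `f'` is non-increasing on `(0, R)`, then `h ↦ f h / h` is non-increasing on `(0, R]`
(`f` is concave on `[0, R]`, and `f h / h` is the secant slope from the origin; `ConcaveOn.slope_anti`). [folklore] -/
theorem chr_antitoneOn_div_of_antitoneOn_deriv {f f' : ℝ → ℝ} {R : ℝ}
    (hder : ∀ h ∈ Icc 0 R, HasDerivAt f (f' h) h) (hf0 : f 0 = 0)
    (hanti : AntitoneOn f' (Ioo 0 R)) :
    AntitoneOn (fun h => f h / h) (Ioc 0 R) := by
  rcases le_or_gt R 0 with hR | hR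
  · intro h₁ hh₁ h₂ hh₂ _
    exact absurd (lt_of_lt_of_le hh₁.1 (hh₁.2.trans hR)) (lt_irrefl 0)
  have hconc : ConcaveOn ℝ (Icc 0 R) f := by
    refine AntitoneOn.concaveOn_of_deriv (convex_Icc _ _) ?_ ?_ ?_
    · exact fun h hh => (hder h hh).continuousAt.continuousWithinAt
    · rw [interior_Icc]
      exact fun h hh => (hder h (Ioo_subset_Icc_self hh)).differentiableAt.differentiableWithinAt
    · rw [interior_Icc]
      intro h₁ hh₁ h₂ hh₂ h12
      rw [(hder h₁ (Ioo_subset_Icc_self hh₁)).deriv, (hder h₂ (Ioo_subset_Icc_self hh₂)).deriv]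
      exact hanti hh₁ hh₂ h12
  have hslope := hconc.slope_anti (left_mem_Icc.mpr hR.le)
  intro h₁ hh₁ h₂ hh₂ h12
  have hmem : ∀ h ∈ Ioc 0 R, h ∈ Icc 0 R \ {0} := fun h hh =>
    ⟨⟨hh.1.le, hh.2⟩, fun h0 => hh.1.ne' h0⟩
  have h := hslope (hmem h₁ hh₁) (hmem h₂ hh₂) h12
  simp only [slope_def_field, hf0, sub_zero] at h
  simpa using h

/-! ### The sourced torus: pressure derivative, pair susceptibility, zero-source amplitude -/

/-- **`d/dh p̃_L(μ, h) = Re⟨Q⟩_h / L²`** for the finite-volume sourced pressure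
`p̃_L(μ,h) = log Z_L(β; dWaveSourceTorus L U μ h)/(βL²)`, `Q = Δ_d + Δ_dᴴ`, `β > 0`
(`hasDerivAt_log_partitionFn_source`). [folklore] -/
theorem chr_hasDerivAt_sourcedPressure (L : ℕ) [NeZero L] (U μ : ℝ) {β : ℝ} (hβ : 0 < β) (h : ℝ) :
    HasDerivAt (fun t : ℝ => Real.log (partitionFn β (dWaveSourceTorus L U μ t)).re / (β * (L : ℝ) ^ 2))
      ((gibbsState β (dWaveSourceTorus L U μ h)
          (pairField dWaveFormFactor L + (pairField dWaveFormFactor L)ᴴ)).re / (L : ℝ) ^ 2) h := by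
  have hL := cast_sq_pos_of_neZero L
  have h1 := hasDerivAt_log_partitionFn_source (isHermitian_hubbardTorusWith L 1 U μ)
    (isHermitian_pairField_add_conjTranspose L) hβ h
  refine (h1.div_const (β * (L : ℝ) ^ 2)).congr_deriv ?_
  show β * (gibbsState β (dWaveSourceTorus L U μ h)
      (pairField dWaveFormFactor L + (pairField dWaveFormFactor L)ᴴ)).re / (β * (L : ℝ) ^ 2) = _
  field_simp

/-- **The pair-susceptibility formula at finite source**: `h ↦ Re⟨Q⟩_h` is differentiable with derivative
`β · b_L(h)`, `b_L(h) = Re (Q,Q)^{Duh}_h − (Re⟨Q⟩_h)²` the truncated Duhamel two-point function of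
`Q = Δ_d + Δ_dᴴ` in the Gibbs state of `dWaveSourceTorus L U μ h` (`hasDerivAt_re_gibbsState_source`). [folklore] -/
theorem chr_hasDerivAt_pairAmplitude (L : ℕ) [NeZero L] (U μ : ℝ) {β : ℝ} (hβ : 0 < β) (h : ℝ) :
    HasDerivAt (fun t : ℝ => (gibbsState β (dWaveSourceTorus L U μ t)
        (pairField dWaveFormFactor L + (pairField dWaveFormFactor L)ᴴ)).re)
      (β * ((duhamel β (dWaveSourceTorus L U μ h)
              (pairField dWaveFormFactor L + (pairField dWaveFormFactor L)ᴴ)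
              (pairField dWaveFormFactor L + (pairField dWaveFormFactor L)ᴴ)).re -
            (gibbsState β (dWaveSourceTorus L U μ h)
              (pairField dWaveFormFactor L + (pairField dWaveFormFactor L)ᴴ)).re ^ 2)) h :=
  hasDerivAt_re_gibbsState_source (isHermitian_hubbardTorusWith L 1 U μ)
    (isHermitian_pairField_add_conjTranspose L) hβ h

/-- **`Re⟨Q⟩_0 = 0`**: without source the pair amplitude vanishes (gauge symmetry; `gibbsState_pairSource_eq_zero`).
[folklore] -/
theorem chr_pairAmplitude_zero (L : ℕ) [NeZero L] (U μ : ℝ) {β : ℝ} (hβ : 0 < β) :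
    (gibbsState β (dWaveSourceTorus L U μ 0)
        (pairField dWaveFormFactor L + (pairField dWaveFormFactor L)ᴴ)).re = 0 := by
  rw [dWaveSourceTorus_zero, gibbsState_pairSource_eq_zero L hβ.ne' U μ, Complex.zero_re]

/-! ### Pointwise equivalence FV-CHORD ⟺ FV-CONC for the sourced torus -/

/-- **FV-CHORD ⟺ FV-CONC, torus by torus.** For every finite torus, `β > 0` and `R > 0`: the chord pair amplitude
`h ↦ Re⟨Q⟩_{β,L,U,μ,h} / h` (`Q = Δ_d + Δ_dᴴ`) is non-increasing on `(0, R]` iff the sourced pressure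
`s ↦ log Z_L(β; dWaveSourceTorus L U μ √s)/(βL²)` is concave on `[0, R²]`. [folklore composition] -/
theorem chr_fvChord_iff_fvConcavity (L : ℕ) [NeZero L] (U μ : ℝ) {β R : ℝ} (hβ : 0 < β) (hR : 0 < R) :
    AntitoneOn (fun h : ℝ => (gibbsState β (dWaveSourceTorus L U μ h)
        (pairField dWaveFormFactor L + (pairField dWaveFormFactor L)ᴴ)).re / h) (Set.Ioc 0 R) ↔
      ConcaveOn ℝ (Set.Icc 0 (R ^ 2)) (fun s : ℝ =>
        Real.log (partitionFn β (dWaveSourceTorus L U μ (Real.sqrt s))).re / (β * (L : ℝ) ^ 2)) := by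
  have hL := cast_sq_pos_of_neZero L
  set F : ℝ → ℝ := fun t => Real.log (partitionFn β (dWaveSourceTorus L U μ t)).re / (β * (L : ℝ) ^ 2)
    with hF
  set F' : ℝ → ℝ := fun t => (gibbsState β (dWaveSourceTorus L U μ t)
      (pairField dWaveFormFactor L + (pairField dWaveFormFactor L)ᴴ)).re / (L : ℝ) ^ 2 with hF'
  have hder : ∀ t : ℝ, HasDerivAt F (F' t) t := fun t => chr_hasDerivAt_sourcedPressure L U μ hβ t
  -- `F' t / t` is the chord divided by `L²`
  have hquot : ∀ t : ℝ, F' t / t = (gibbsState β (dWaveSourceTorus L U μ t)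
      (pairField dWaveFormFactor L + (pairField dWaveFormFactor L)ᴴ)).re / t / (L : ℝ) ^ 2 := by
    intro t; simp only [hF']; rw [div_right_comm]
  constructor
  · intro hanti
    have h := chr_concaveOn_comp_sqrt_of_antitoneOn (F := F) (F' := F') le_rfl hR
      (fun t _ => (hder t).continuousAt.continuousWithinAt) (fun t _ => hder t) ?_
    · rw [show ((0 : ℝ) ^ 2) = 0 by norm_num] at h
      exact h
    · intro s hs t ht hst
      simp only [hquot]
      exact div_le_div_of_nonneg_right (hanti ⟨hs.1, hs.2.le⟩ ⟨ht.1, ht.2.le⟩ hst) hL.le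
  · intro hconc
    have hconc' : ConcaveOn ℝ (Set.Icc ((0 : ℝ) ^ 2) (R ^ 2)) (fun s => F (Real.sqrt s)) := by
      rw [show ((0 : ℝ) ^ 2) = 0 by norm_num]
      exact hconc
    have h := chr_antitoneOn_of_concaveOn_comp_sqrt (F := F) (F' := F') le_rfl hR hconc'
      (fun t _ => hder t)
    intro s hs t ht hst
    have h' := h hs ht hst
    simp only [hquot] at h'
    have := mul_le_mul_of_nonneg_right h' hL.le
    rwa [div_mul_cancel₀ _ hL.ne', div_mul_cancel₀ _ hL.ne'] at this

/-! ### Reductions -/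

/-- **FV-CHORD ⟹ R (no use of `TwSourcedCondensation`).** If on every window `[μ₁, μ₂] ⊂ (−4, 0)` there are
`a, K', U₀ > 0` such that for `U ∈ (0, U₀]`, `g ∈ [K'U, 1/10]` and interior `μ`, eventually in `L`, the chord pair
amplitude `h ↦ Re⟨Δ_d + Δ_dᴴ⟩_{e^{a/U},L,U,μ,h} / h` of the cold sourced torus is non-increasing on `(0, 13g+1]`, then
`TwSeededEnsembleEquivalenceR` (`chr_fvChord_iff_fvConcavity` ∘ `twR_of_fvConcavity`). [folklore composition] -/
theorem twR_of_fvChordMonotone :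
    (∀ (μ₁ μ₂ : ℝ), -4 < μ₁ → μ₁ < μ₂ → μ₂ < 0 → ∃ a K' U₀ : ℝ, 0 < a ∧ 0 < K' ∧ 0 < U₀ ∧
      ∀ U ∈ Set.Ioc (0 : ℝ) U₀, ∀ g ∈ Set.Icc (K' * U) (1 / 10), ∀ μ ∈ Set.Ioo μ₁ μ₂,
        ∃ L₀ : ℕ, ∀ (L : ℕ) [NeZero L], L₀ ≤ L →
          AntitoneOn (fun h : ℝ => (Matrix.gibbsState (Real.exp (a / U)) (dWaveSourceTorus L U μ h)
            (pairField dWaveFormFactor L + (pairField dWaveFormFactor L)ᴴ)).re / h)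
            (Set.Ioc 0 (13 * g + 1))) →
    TwSeededEnsembleEquivalenceR := by
  intro hCH
  refine twR_of_fvConcavity fun μ₁ μ₂ h4 h12 h0 => ?_
  obtain ⟨a, K', U₀, ha, hK', hU₀, hA⟩ := hCH μ₁ μ₂ h4 h12 h0
  refine ⟨a, K', U₀, ha, hK', hU₀, fun U hU g hg μ hμ => ?_⟩
  obtain ⟨L₀, hL₀⟩ := hA U hU g hg μ hμ
  refine ⟨L₀, fun L _ hL => ?_⟩
  have hg0 : 0 < g := lt_of_lt_of_le (mul_pos hK' hU.1) hg.1
  have hR : 0 < 13 * g + 1 := by positivity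
  exact (chr_fvChord_iff_fvConcavity L U μ (Real.exp_pos _) hR).mp (hL₀ L hL)

/-- **FV-MONO-χ ⟹ R (no use of `TwSourcedCondensation`).** It suffices that, in the same regime and eventually in
`L`, the truncated Duhamel pair susceptibility at finite source
`h ↦ Re (Q,Q)^{Duh}_{e^{a/U},L,U,μ,h} − (Re⟨Q⟩_{e^{a/U},L,U,μ,h})²` (`Q = Δ_d + Δ_dᴴ`; `= β⁻¹ d/dh Re⟨Q⟩_h`) is
non-increasing on `[0, 13g+1]`: with `⟨Q⟩_0 = 0` the pair-amplitude curve is concave through the origin, so its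
chords are non-increasing (`chr_antitoneOn_div_of_antitoneOn_deriv`), and `twR_of_fvChordMonotone` applies. This
GHS-type condition (`∂ₕ³ log Z_L ≤ 0` on `h ≥ 0`) is stronger than FV-CHORD. [folklore composition] -/
theorem twR_of_fvSusceptibilityMonotone :
    (∀ (μ₁ μ₂ : ℝ), -4 < μ₁ → μ₁ < μ₂ → μ₂ < 0 → ∃ a K' U₀ : ℝ, 0 < a ∧ 0 < K' ∧ 0 < U₀ ∧
      ∀ U ∈ Set.Ioc (0 : ℝ) U₀, ∀ g ∈ Set.Icc (K' * U) (1 / 10), ∀ μ ∈ Set.Ioo μ₁ μ₂,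
        ∃ L₀ : ℕ, ∀ (L : ℕ) [NeZero L], L₀ ≤ L →
          AntitoneOn (fun h : ℝ =>
            (Matrix.duhamel (Real.exp (a / U)) (dWaveSourceTorus L U μ h)
                (pairField dWaveFormFactor L + (pairField dWaveFormFactor L)ᴴ)
                (pairField dWaveFormFactor L + (pairField dWaveFormFactor L)ᴴ)).re -
              (Matrix.gibbsState (Real.exp (a / U)) (dWaveSourceTorus L U μ h)
                (pairField dWaveFormFactor L + (pairField dWaveFormFactor L)ᴴ)).re ^ 2)
            (Set.Icc 0 (13 * g + 1))) →
    TwSeededEnsembleEquivalenceR := by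
  intro hMONO
  refine twR_of_fvChordMonotone fun μ₁ μ₂ h4 h12 h0 => ?_
  obtain ⟨a, K', U₀, ha, hK', hU₀, hA⟩ := hMONO μ₁ μ₂ h4 h12 h0
  refine ⟨a, K', U₀, ha, hK', hU₀, fun U hU g hg μ hμ => ?_⟩
  obtain ⟨L₀, hL₀⟩ := hA U hU g hg μ hμ
  refine ⟨L₀, fun L _ hL => ?_⟩
  set β : ℝ := Real.exp (a / U) with hβ_def
  have hβ : 0 < β := Real.exp_pos _
  refine chr_antitoneOn_div_of_antitoneOn_deriv (R := 13 * g + 1)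
    (fun h _ => chr_hasDerivAt_pairAmplitude L U μ hβ h) (chr_pairAmplitude_zero L U μ hβ) ?_
  intro s hs t ht hst
  exact mul_le_mul_of_nonneg_left
    ((hL₀ L hL) (Ioo_subset_Icc_self hs) (Ioo_subset_Icc_self ht) hst) hβ.le

/-- **`TwSourcedCondensation` + FV-DEEP-CHORD ⟹ R.** Chord monotonicity only on the regulated deep range
`[e^{−a/(4U)}, 13g+1]`, for all small exponents `a ∈ (0, a₁]` (the quantifier shape of the lead's DEEP-UNIQ′), gives
concavity in `s` on `[e^{−a/(2U)}, (13g+1)²]` (`chr_concaveOn_comp_sqrt_of_antitoneOn` with `r = e^{−a/(4U)}`), and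
`twR_of_condensation_of_fvDeepConcavity` (optimiser floor from `TwSourcedCondensation`) concludes.
[folklore composition] -/
theorem twR_of_condensation_of_fvDeepChordMonotone :
    TwSourcedCondensation →
    (∀ (μ₁ μ₂ : ℝ), -4 < μ₁ → μ₁ < μ₂ → μ₂ < 0 → ∃ a₁ : ℝ, 0 < a₁ ∧ ∀ a ∈ Set.Ioc (0 : ℝ) a₁,
      ∃ K' U₀ : ℝ, 0 < K' ∧ 0 < U₀ ∧ ∀ U ∈ Set.Ioc (0 : ℝ) U₀, ∀ g ∈ Set.Icc (K' * U) (1 / 10),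
        ∀ μ ∈ Set.Ioo μ₁ μ₂, ∃ L₀ : ℕ, ∀ (L : ℕ) [NeZero L], L₀ ≤ L →
          AntitoneOn (fun h : ℝ => (Matrix.gibbsState (Real.exp (a / U)) (dWaveSourceTorus L U μ h)
            (pairField dWaveFormFactor L + (pairField dWaveFormFactor L)ᴴ)).re / h)
            (Set.Icc (Real.exp (-(a / (4 * U)))) (13 * g + 1))) →
    TwSeededEnsembleEquivalenceR := by
  intro hC hDCH
  refine twR_of_condensation_of_fvDeepConcavity hC fun μ₁ μ₂ h4 h12 h0 => ?_
  obtain ⟨a₁, ha₁, hA⟩ := hDCH μ₁ μ₂ h4 h12 h0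
  refine ⟨a₁, ha₁, fun a ha => ?_⟩
  obtain ⟨K', U₀, hK', hU₀, hB⟩ := hA a ha
  refine ⟨K', U₀, hK', hU₀, fun U hU g hg μ hμ => ?_⟩
  obtain ⟨L₀, hL₀⟩ := hB U hU g hg μ hμ
  refine ⟨L₀, fun L _ hL => ?_⟩
  have hLsq := cast_sq_pos_of_neZero L
  set β : ℝ := Real.exp (a / U) with hβ_def
  have hβ : 0 < β := Real.exp_pos _
  set r : ℝ := Real.exp (-(a / (4 * U))) with hr_def
  have hr : 0 ≤ r := (Real.exp_pos _).le
  have hg0 : 0 < g := lt_of_lt_of_le (mul_pos hK' hU.1) hg.1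
  have hr1 : r < 1 := by
    rw [hr_def]
    refine Real.exp_lt_one_iff.2 ?_
    have : 0 < a / (4 * U) := div_pos ha.1 (by linarith [hU.1])
    linarith
  have hrR : r < 13 * g + 1 := by linarith
  have hr2 : r ^ 2 = Real.exp (-(a / (2 * U))) := by
    rw [hr_def, sq, ← Real.exp_add]
    congr 1
    ring
  set F : ℝ → ℝ := fun t => Real.log (partitionFn β (dWaveSourceTorus L U μ t)).re / (β * (L : ℝ) ^ 2)
    with hF
  set F' : ℝ → ℝ := fun t => (gibbsState β (dWaveSourceTorus L U μ t)
      (pairField dWaveFormFactor L + (pairField dWaveFormFactor L)ᴴ)).re / (L : ℝ) ^ 2 with hF'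
  have hder : ∀ t : ℝ, HasDerivAt F (F' t) t := fun t => chr_hasDerivAt_sourcedPressure L U μ hβ t
  have h := chr_concaveOn_comp_sqrt_of_antitoneOn (F := F) (F' := F') hr hrR
    (fun t _ => (hder t).continuousAt.continuousWithinAt) (fun t _ => hder t) ?_
  · rw [hr2] at h
    exact h
  · intro s hs t ht hst
    simp only [hF']
    rw [div_right_comm _ _ s, div_right_comm _ _ t]
    exact div_le_div_of_nonneg_right
      ((hL₀ L hL) (Ioo_subset_Icc_self hs) (Ioo_subset_Icc_self ht) hst) hLsq.le

end

end Summit.HubbardSuperconductivity.HubbardSuperconductivity.Theorems
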